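import Literature.ModelTheory.Zilber.EACGraphFibres
import HarnessLib

/-!
# EAC ladder — the graph-escape families `E_D` / `E_D^top` as certified graph-fibre varieties;
model members over cubic, quartic and periodic bases

Typed support for the case ladder of Zilber's Exponential-Algebraic-Closedness conjecture
(`Literature.ModelTheory.Zilber.EAC`; first open rung `ECCell 3 2 = ECCellAperiodic 2 ∧
ECCellPeriodic 2`, `EACAperiodicBase.ecCell_three_two_iff`).

The problem side (`Summits/Schanuel/Schanuel/Theorems/ZilberEacComplexGraphEscape{,Top,Examples,
TopExamples}`) proves the **graph-escape theorems of arbitrary degree**: for `g ∈ ℂ[x₁..x_s]` of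
total degree `D ≥ 2`, `κ ∈ ℕˢ` with `g_D(κ) ≠ 0`, `cⱼ ≠ 0` (resp. top coefficients `Tⱼ ∈ ℂ[x']` with
`(Tⱼ)_{deg Tⱼ}(κ) ≠ 0`) and ARBITRARY lower coefficients `A_{j,i} ∈ ℂ[x']`, the system
`exp xⱼ = cⱼ (e^{g(x)})^{κⱼ} + Σ_{i<κⱼ} A_{j,i}(x) (e^{g(x)})^i` (`j ≤ s`) has a solution. In EC
vocabulary (`n = s + 1`) these are the subvarieties
`E(g; κ, c, A) = {xₙ = g(x'), yⱼ = cⱼ yₙ^{κⱼ} + Σ_{i<κⱼ} A_{j,i}(x') yₙ^i}` and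
`E^top(g; κ, T, A) = {xₙ = g(x'), yⱼ = Tⱼ(x') yₙ^{κⱼ} + Σ_{i<κⱼ} A_{j,i}(x') yₙ^i}` of `ℂⁿ × ℂⁿ`.

This file records, sorry-free:

* `graphEscapeVariety` / `graphEscapeTopVariety` — LITERALLY the sets of the problem side's
  `graphEscape_inter_expGraph_nonempty` / `graphEscapeTop_inter_expGraph_nonempty` — are
  graph-fibre varieties `W(g; P)` of `EACGraphFibres` (`…_eq_graphFibreVariety`), so the gen-7
  certificates apply verbatim: ONE dominant slice `x' ↦ P(u₀, x')` (+ `deg g ≥ 2`, resp. `s ≥ 1` and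
  an (a)periodic base) makes `E(g; κ, c, A)` a certified member of `ECCell (s+1) s`
  (resp. `ECCellAperiodic s` / `ECCellPeriodic s`); the slices are computed (`fibreSlice_escapeFibrePoly`,
  at `u₀ = 0` the slice is the vector of bottom coefficients `(A_{j,0})ⱼ` when all `κⱼ ≥ 1`);
* the dictionaries `…_inter_expGraph_nonempty_iff`: exponential points ↔ solutions of the
  problem-side systems, conclusion shapes verbatim;
* HONEST CAVEAT made formal by the hypotheses: the escape families are NOT contained in the cell —
  `κⱼ = 0` gives a constant fibre `yⱼ = cⱼ`, `A ≡ 0` gives the subtorus translate `yⱼ = cⱼyₙ^{κⱼ}`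
  (not multiplicatively free); membership is exactly the dominant-slice condition;
* four explicit certified members with their dictionaries: the problem side's cubic mixed-powers
  model `{x₃ = x₁³ + x₂³, y₁ = y₃ + x₁, y₂ = y₃² - x₂}`, quartic model
  `{x₃ = x₁x₂³, y₁ = y₃ + x₂, y₂ = y₃ + x₁}` and moving-top model
  `{x₃ = x₁² + x₂², y₁ = x₁y₃ + 1, y₂ = x₂y₃ + 1}` — all three in `ECCellAperiodic 2` (bases
  aperiodic by the point form of the graph-base criterion) — and the PERIODIC-base model
  `{x₃ = (x₁ - x₂)³, y₁ = y₃ + x₁, y₂ = y₃² - x₂}` (period `(1,1,0)`), a certified member of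
  `ECCellPeriodic 2` whose system `e^z = e^{(z-w)³} + z ∧ e^w = (e^{(z-w)³})² - w` is an instance of
  the problem side's `exists_expPoint_graphEscape_powers` (`κ = (1,2)`, `g₃(κ) = -1 ≠ 0`): the escape
  theorems also populate the periodic half of `EC(3,2)`.

HONEST FRAMING. Bookkeeping for modest rungs of EAC: nothing here proves a case of EAC (the
exponential points are found problem-side; this file cannot import `Summits`), `ECCell 3 2` and both
its halves remain OPEN, and nothing here bears on Schanuel's conjecture (EAC is a different
statement; EAC ⇏ SC). No statement of this file is a cited literature fact; the `[cite:]` tags are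
attributions of the QUESTION (Mantova–Masser's open case), all theorems are proved here.

Sources: Mantova–Masser 2024 (MantovaMasser2023, arXiv:2303.05592) §1 p. 5 (the open case
`dim π(V) = 2` in `ℂ³ × (ℂˣ)³` and its model system); Zilber 2005 §3 (freeness, rotundity);
Bays–Kirby 2018 Def. 7.1.
-/

noncomputable section

open MvPolynomial

namespace Literature.ModelTheory.Zilber

open Literature.NumberTheory.Transcendental

/-! ### The escape family `E(g; κ, c, A)` -/

section EscapeFibres

variable {s : ℕ} (g : MvPolynomial (Fin s) ℂ) (κ : Fin s → ℕ) (c : Fin s → ℂ)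
  (A : Fin s → ℕ → MvPolynomial (Fin s) ℂ)

/-- **The graph-escape variety `E(g; κ, c, A) ⊆ ℂⁿ × ℂⁿ`** (`n = s + 1`):
`xₙ = g(x')`, `yⱼ = cⱼ yₙ^{κⱼ} + Σ_{i<κⱼ} A_{j,i}(x') yₙ^i` — LITERALLY the set of
`Summit.Schanuel.Schanuel.Theorems.graphEscape_inter_expGraph_nonempty`.
[cite: MantovaMasser2023, §1 p. 5 (the open case dim π(V) = 2 in ℂ³ × (ℂˣ)³)] -/
def graphEscapeVariety : Set (Fin (s + 1) ⊕ Fin (s + 1) → ℂ) :=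
  {z | z (Sum.inl (Fin.last s)) = eval (fun j => z (Sum.inl (Fin.castSucc j))) g ∧
    ∀ j : Fin s, z (Sum.inr (Fin.castSucc j)) =
      c j * z (Sum.inr (Fin.last s)) ^ (κ j) +
        ∑ i ∈ Finset.range (κ j), eval (fun l => z (Sum.inl (Fin.castSucc l))) (A j i) *
          z (Sum.inr (Fin.last s)) ^ i}

/-- The escape fibre polynomials `cⱼ u^{κⱼ} + Σ_{i<κⱼ} A_{j,i}(x') u^i ∈ ℂ[u, x']`. [folklore] -/
def escapeFibrePoly : Fin s → MvPolynomial (Fin (s + 1)) ℂ := fun j =>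
  C (c j) * X 0 ^ (κ j) + ∑ i ∈ Finset.range (κ j), rename Fin.succ (A j i) * X 0 ^ i

/-- **`E(g; κ, c, A) = W(g; escapeFibrePoly)`**: the escape family is a graph-fibre variety.
[folklore] -/
theorem graphEscapeVariety_eq_graphFibreVariety :
    graphEscapeVariety g κ c A = graphFibreVariety g (escapeFibrePoly κ c A) := by
  ext z
  simp only [graphEscapeVariety, mem_graphFibreVariety_iff, escapeFibrePoly, map_add, map_mul,
    map_pow, map_sum, eval_C, eval_X, Fin.cons_zero, eval_rename, cons_comp_succ, Set.mem_setOf_eq]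

/-- The slice of the escape fibres at height `u₀`: `x' ↦ (cⱼu₀^{κⱼ} + Σ_{i<κⱼ} A_{j,i}(x')u₀^i)ⱼ`.
[folklore] -/
theorem fibreSlice_escapeFibrePoly (u₀ : ℂ) :
    fibreSlice (escapeFibrePoly κ c A) u₀ = fun j =>
      C (c j) * C u₀ ^ (κ j) + ∑ i ∈ Finset.range (κ j), A j i * C u₀ ^ i := by
  funext j
  simp only [fibreSlice, escapeFibrePoly, map_add, map_mul, map_pow, map_sum, aeval_C,
    algebraMap_eq, aeval_X, Fin.cons_zero, aeval_rename, cons_comp_succ, aeval_X_left_apply]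

/-- **At `u₀ = 0` the slice is the vector of bottom coefficients `(A_{j,0})ⱼ`** (all `κⱼ ≥ 1`).
[folklore] -/
theorem fibreSlice_escapeFibrePoly_zero (hκ : ∀ j, 0 < κ j) :
    fibreSlice (escapeFibrePoly κ c A) 0 = fun j => A j 0 := by
  funext j
  rw [fibreSlice_escapeFibrePoly]
  simp only [map_zero, zero_pow (hκ j).ne', mul_zero, zero_add]
  rw [Finset.sum_eq_single 0]
  · simp
  · intro i _ hi
    simp [hi]
  · intro h
    exact absurd (Finset.mem_range.mpr (hκ j)) h

/-- **`E(g; κ, c, A)` satisfies the seven hypotheses of `ECCell (s+1) s`** when some slice is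
dominant and `deg g ≥ 2` (binders in order). [folklore] -/
theorem ecCell_hypotheses_graphEscapeVariety (u₀ : ℂ)
    (hP : Function.Injective (aeval (fibreSlice (escapeFibrePoly κ c A) u₀) :
      MvPolynomial (Fin s) ℂ →ₐ[ℂ] MvPolynomial (Fin s) ℂ))
    (hg : 2 ≤ g.totalDegree) :
    IsIrreducibleClosed ℂ (graphEscapeVariety g κ c A) ∧
    (graphEscapeVariety g κ c A ∩ torusLocus ℂ (s + 1)).Nonempty ∧
    IsRotund ℂ (s + 1) (graphEscapeVariety g κ c A ∩ torusLocus ℂ (s + 1)) ∧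
    IsAddFree ℂ (s + 1) (graphEscapeVariety g κ c A ∩ torusLocus ℂ (s + 1)) ∧
    IsMulFree ℂ (s + 1) (graphEscapeVariety g κ c A ∩ torusLocus ℂ (s + 1)) ∧
    zariskiDim ℂ (graphEscapeVariety g κ c A) = (s + 1 : ℕ) ∧
    addProjDim ℂ (s + 1) (graphEscapeVariety g κ c A) = (s : ℕ) := by
  rw [graphEscapeVariety_eq_graphFibreVariety]
  exact ecCell_hypotheses_graphFibreVariety g _ u₀ hP hg

/-- **Dominant slice, `s ≥ 1`, aperiodic base ⇒ `E(g; κ, c, A)` is a member of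
`ECCellAperiodic s`** (seven binders in order). [folklore] -/
theorem ecCellAperiodic_hypotheses_graphEscapeVariety (u₀ : ℂ)
    (hP : Function.Injective (aeval (fibreSlice (escapeFibrePoly κ c A) u₀) :
      MvPolynomial (Fin s) ℂ →ₐ[ℂ] MvPolynomial (Fin s) ℂ))
    (hs : 0 < s) (haper : ¬ HasIntegerPeriod ℂ (graphBase g)) :
    IsIrreducibleClosed ℂ (graphEscapeVariety g κ c A) ∧
    (graphEscapeVariety g κ c A ∩ torusLocus ℂ (s + 1)).Nonempty ∧
    IsAddFree ℂ (s + 1) (graphEscapeVariety g κ c A ∩ torusLocus ℂ (s + 1)) ∧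
    IsMulFree ℂ (s + 1) (graphEscapeVariety g κ c A ∩ torusLocus ℂ (s + 1)) ∧
    zariskiDim ℂ (graphEscapeVariety g κ c A) = (s + 1 : ℕ) ∧
    addProjDim ℂ (s + 1) (graphEscapeVariety g κ c A) = (s : ℕ) ∧
    ¬ HasIntegerPeriod ℂ (projAdd '' (graphEscapeVariety g κ c A ∩ torusLocus ℂ (s + 1))) := by
  rw [graphEscapeVariety_eq_graphFibreVariety]
  exact ecCellAperiodic_hypotheses_graphFibreVariety g _ u₀ hP hs haper

/-- **Dominant slice, `deg g ≥ 2`, periodic base ⇒ `E(g; κ, c, A)` is a member of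
`ECCellPeriodic s`** (eight binders in order). [folklore] -/
theorem ecCellPeriodic_hypotheses_graphEscapeVariety (u₀ : ℂ)
    (hP : Function.Injective (aeval (fibreSlice (escapeFibrePoly κ c A) u₀) :
      MvPolynomial (Fin s) ℂ →ₐ[ℂ] MvPolynomial (Fin s) ℂ))
    (hg : 2 ≤ g.totalDegree) (hper : HasIntegerPeriod ℂ (graphBase g)) :
    IsIrreducibleClosed ℂ (graphEscapeVariety g κ c A) ∧
    (graphEscapeVariety g κ c A ∩ torusLocus ℂ (s + 1)).Nonempty ∧
    IsRotund ℂ (s + 1) (graphEscapeVariety g κ c A ∩ torusLocus ℂ (s + 1)) ∧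
    IsAddFree ℂ (s + 1) (graphEscapeVariety g κ c A ∩ torusLocus ℂ (s + 1)) ∧
    IsMulFree ℂ (s + 1) (graphEscapeVariety g κ c A ∩ torusLocus ℂ (s + 1)) ∧
    zariskiDim ℂ (graphEscapeVariety g κ c A) = (s + 1 : ℕ) ∧
    addProjDim ℂ (s + 1) (graphEscapeVariety g κ c A) = (s : ℕ) ∧
    HasIntegerPeriod ℂ (projAdd '' (graphEscapeVariety g κ c A ∩ torusLocus ℂ (s + 1))) := by
  rw [graphEscapeVariety_eq_graphFibreVariety]
  exact ecCellPeriodic_hypotheses_graphFibreVariety g _ u₀ hP hg hper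

/-- **Bottom-coefficient criterion**: all `κⱼ ≥ 1`, `x' ↦ (A_{j,0}(x'))ⱼ` dominant, `s ≥ 1`, base
aperiodic ⇒ `E(g; κ, c, A) ∈ ECCellAperiodic s` (the slice `u₀ = 0`). [folklore] -/
theorem ecCellAperiodic_hypotheses_graphEscapeVariety_of_bottom (hκ : ∀ j, 0 < κ j)
    (hA : Function.Injective (aeval (fun j => A j 0) :
      MvPolynomial (Fin s) ℂ →ₐ[ℂ] MvPolynomial (Fin s) ℂ))
    (hs : 0 < s) (haper : ¬ HasIntegerPeriod ℂ (graphBase g)) :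
    IsIrreducibleClosed ℂ (graphEscapeVariety g κ c A) ∧
    (graphEscapeVariety g κ c A ∩ torusLocus ℂ (s + 1)).Nonempty ∧
    IsAddFree ℂ (s + 1) (graphEscapeVariety g κ c A ∩ torusLocus ℂ (s + 1)) ∧
    IsMulFree ℂ (s + 1) (graphEscapeVariety g κ c A ∩ torusLocus ℂ (s + 1)) ∧
    zariskiDim ℂ (graphEscapeVariety g κ c A) = (s + 1 : ℕ) ∧
    addProjDim ℂ (s + 1) (graphEscapeVariety g κ c A) = (s : ℕ) ∧
    ¬ HasIntegerPeriod ℂ (projAdd '' (graphEscapeVariety g κ c A ∩ torusLocus ℂ (s + 1))) :=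
  ecCellAperiodic_hypotheses_graphEscapeVariety g κ c A 0
    (by rw [fibreSlice_escapeFibrePoly_zero κ c A hκ]; exact hA) hs haper

/-- `ECCell (s+1) s` ⇒ `E(g; κ, c, A)` meets `Γ_exp` (dominant slice, `deg g ≥ 2`). [folklore] -/
theorem graphEscapeVariety_inter_expGraph_nonempty_of_ecCell (u₀ : ℂ)
    (hP : Function.Injective (aeval (fibreSlice (escapeFibrePoly κ c A) u₀) :
      MvPolynomial (Fin s) ℂ →ₐ[ℂ] MvPolynomial (Fin s) ℂ))
    (hg : 2 ≤ g.totalDegree) (h : ECCell (s + 1) s) :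
    (graphEscapeVariety g κ c A ∩ expGraph ℂ (s + 1)).Nonempty := by
  rw [graphEscapeVariety_eq_graphFibreVariety]
  exact graphFibreVariety_inter_expGraph_nonempty_of_ecCell g _ u₀ hP hg h

/-- `ECCellAperiodic s` ⇒ `E(g; κ, c, A)` meets `Γ_exp` (dominant slice, `s ≥ 1`, aperiodic base).
[folklore] -/
theorem graphEscapeVariety_inter_expGraph_nonempty_of_ecCellAperiodic (u₀ : ℂ)
    (hP : Function.Injective (aeval (fibreSlice (escapeFibrePoly κ c A) u₀) :
      MvPolynomial (Fin s) ℂ →ₐ[ℂ] MvPolynomial (Fin s) ℂ))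
    (hs : 0 < s) (haper : ¬ HasIntegerPeriod ℂ (graphBase g)) (h : ECCellAperiodic s) :
    (graphEscapeVariety g κ c A ∩ expGraph ℂ (s + 1)).Nonempty := by
  rw [graphEscapeVariety_eq_graphFibreVariety]
  exact graphFibreVariety_inter_expGraph_nonempty_of_ecCellAperiodic g _ u₀ hP hs haper h

/-- `ECCellPeriodic s` ⇒ `E(g; κ, c, A)` meets `Γ_exp` (dominant slice, `deg g ≥ 2`, periodic
base). [folklore] -/
theorem graphEscapeVariety_inter_expGraph_nonempty_of_ecCellPeriodic (u₀ : ℂ)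
    (hP : Function.Injective (aeval (fibreSlice (escapeFibrePoly κ c A) u₀) :
      MvPolynomial (Fin s) ℂ →ₐ[ℂ] MvPolynomial (Fin s) ℂ))
    (hg : 2 ≤ g.totalDegree) (hper : HasIntegerPeriod ℂ (graphBase g)) (h : ECCellPeriodic s) :
    (graphEscapeVariety g κ c A ∩ expGraph ℂ (s + 1)).Nonempty := by
  rw [graphEscapeVariety_eq_graphFibreVariety]
  exact graphFibreVariety_inter_expGraph_nonempty_of_ecCellPeriodic g _ u₀ hP hg hper h

/-- **Exponential points of `E(g; κ, c, A)` ↔ solutions of**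
`exp xⱼ = cⱼ (e^{g(x)})^{κⱼ} + Σ_{i<κⱼ} A_{j,i}(x) (e^{g(x)})^i` — EXACTLY the conclusion of
`Summit.….exists_expPoint_graphEscape`. [folklore] -/
theorem graphEscapeVariety_inter_expGraph_nonempty_iff :
    (graphEscapeVariety g κ c A ∩ expGraph ℂ (s + 1)).Nonempty ↔
      ∃ x : Fin s → ℂ, ∀ j, Complex.exp (x j) =
        c j * Complex.exp (eval x g) ^ (κ j) +
          ∑ i ∈ Finset.range (κ j), eval x (A j i) * Complex.exp (eval x g) ^ i := by
  rw [graphEscapeVariety_eq_graphFibreVariety, graphFibreVariety_inter_expGraph_nonempty_iff]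
  refine exists_congr fun x => forall_congr' fun j => ?_
  simp only [escapeFibrePoly, map_add, map_mul, map_pow, map_sum, eval_C, eval_X, Fin.cons_zero,
    eval_rename, cons_comp_succ]

end EscapeFibres

/-! ### The escape family with polynomial top coefficients `E^top(g; κ, T, A)` -/

section EscapeTopFibres

variable {s : ℕ} (g : MvPolynomial (Fin s) ℂ) (κ : Fin s → ℕ) (T : Fin s → MvPolynomial (Fin s) ℂ)
  (A : Fin s → ℕ → MvPolynomial (Fin s) ℂ)

/-- **`E^top(g; κ, T, A) ⊆ ℂⁿ × ℂⁿ`**: `xₙ = g(x')`,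
`yⱼ = Tⱼ(x') yₙ^{κⱼ} + Σ_{i<κⱼ} A_{j,i}(x') yₙ^i` — LITERALLY the set of
`Summit.Schanuel.Schanuel.Theorems.graphEscapeTop_inter_expGraph_nonempty`.
[cite: MantovaMasser2023, §1 p. 5 (the open case dim π(V) = 2 in ℂ³ × (ℂˣ)³)] -/
def graphEscapeTopVariety : Set (Fin (s + 1) ⊕ Fin (s + 1) → ℂ) :=
  {z | z (Sum.inl (Fin.last s)) = eval (fun j => z (Sum.inl (Fin.castSucc j))) g ∧
    ∀ j : Fin s, z (Sum.inr (Fin.castSucc j)) =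
      eval (fun l => z (Sum.inl (Fin.castSucc l))) (T j) * z (Sum.inr (Fin.last s)) ^ (κ j) +
        ∑ i ∈ Finset.range (κ j), eval (fun l => z (Sum.inl (Fin.castSucc l))) (A j i) *
          z (Sum.inr (Fin.last s)) ^ i}

/-- The fibre polynomials `Tⱼ(x') u^{κⱼ} + Σ_{i<κⱼ} A_{j,i}(x') u^i ∈ ℂ[u, x']`. [folklore] -/
def escapeTopFibrePoly : Fin s → MvPolynomial (Fin (s + 1)) ℂ := fun j =>
  rename Fin.succ (T j) * X 0 ^ (κ j) + ∑ i ∈ Finset.range (κ j), rename Fin.succ (A j i) * X 0 ^ i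

/-- **`E^top(g; κ, T, A) = W(g; escapeTopFibrePoly)`**. [folklore] -/
theorem graphEscapeTopVariety_eq_graphFibreVariety :
    graphEscapeTopVariety g κ T A = graphFibreVariety g (escapeTopFibrePoly κ T A) := by
  ext z
  simp only [graphEscapeTopVariety, mem_graphFibreVariety_iff, escapeTopFibrePoly, map_add,
    map_mul, map_pow, map_sum, eval_X, Fin.cons_zero, eval_rename, cons_comp_succ,
    Set.mem_setOf_eq]

/-- The slice of the top-coefficient fibres at height `u₀`. [folklore] -/
theorem fibreSlice_escapeTopFibrePoly (u₀ : ℂ) :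
    fibreSlice (escapeTopFibrePoly κ T A) u₀ = fun j =>
      T j * C u₀ ^ (κ j) + ∑ i ∈ Finset.range (κ j), A j i * C u₀ ^ i := by
  funext j
  simp only [fibreSlice, escapeTopFibrePoly, map_add, map_mul, map_pow, map_sum, aeval_X,
    Fin.cons_zero, aeval_rename, cons_comp_succ, aeval_X_left_apply]

/-- **`E^top(g; κ, T, A)` satisfies the seven hypotheses of `ECCell (s+1) s`** when some slice is
dominant and `deg g ≥ 2` (binders in order). [folklore] -/
theorem ecCell_hypotheses_graphEscapeTopVariety (u₀ : ℂ)
    (hP : Function.Injective (aeval (fibreSlice (escapeTopFibrePoly κ T A) u₀) :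
      MvPolynomial (Fin s) ℂ →ₐ[ℂ] MvPolynomial (Fin s) ℂ))
    (hg : 2 ≤ g.totalDegree) :
    IsIrreducibleClosed ℂ (graphEscapeTopVariety g κ T A) ∧
    (graphEscapeTopVariety g κ T A ∩ torusLocus ℂ (s + 1)).Nonempty ∧
    IsRotund ℂ (s + 1) (graphEscapeTopVariety g κ T A ∩ torusLocus ℂ (s + 1)) ∧
    IsAddFree ℂ (s + 1) (graphEscapeTopVariety g κ T A ∩ torusLocus ℂ (s + 1)) ∧
    IsMulFree ℂ (s + 1) (graphEscapeTopVariety g κ T A ∩ torusLocus ℂ (s + 1)) ∧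
    zariskiDim ℂ (graphEscapeTopVariety g κ T A) = (s + 1 : ℕ) ∧
    addProjDim ℂ (s + 1) (graphEscapeTopVariety g κ T A) = (s : ℕ) := by
  rw [graphEscapeTopVariety_eq_graphFibreVariety]
  exact ecCell_hypotheses_graphFibreVariety g _ u₀ hP hg

/-- **Dominant slice, `s ≥ 1`, aperiodic base ⇒ `E^top(g; κ, T, A) ∈ ECCellAperiodic s`** (seven
binders in order). [folklore] -/
theorem ecCellAperiodic_hypotheses_graphEscapeTopVariety (u₀ : ℂ)
    (hP : Function.Injective (aeval (fibreSlice (escapeTopFibrePoly κ T A) u₀) :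
      MvPolynomial (Fin s) ℂ →ₐ[ℂ] MvPolynomial (Fin s) ℂ))
    (hs : 0 < s) (haper : ¬ HasIntegerPeriod ℂ (graphBase g)) :
    IsIrreducibleClosed ℂ (graphEscapeTopVariety g κ T A) ∧
    (graphEscapeTopVariety g κ T A ∩ torusLocus ℂ (s + 1)).Nonempty ∧
    IsAddFree ℂ (s + 1) (graphEscapeTopVariety g κ T A ∩ torusLocus ℂ (s + 1)) ∧
    IsMulFree ℂ (s + 1) (graphEscapeTopVariety g κ T A ∩ torusLocus ℂ (s + 1)) ∧
    zariskiDim ℂ (graphEscapeTopVariety g κ T A) = (s + 1 : ℕ) ∧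
    addProjDim ℂ (s + 1) (graphEscapeTopVariety g κ T A) = (s : ℕ) ∧
    ¬ HasIntegerPeriod ℂ (projAdd '' (graphEscapeTopVariety g κ T A ∩ torusLocus ℂ (s + 1))) := by
  rw [graphEscapeTopVariety_eq_graphFibreVariety]
  exact ecCellAperiodic_hypotheses_graphFibreVariety g _ u₀ hP hs haper

/-- **Dominant slice, `deg g ≥ 2`, periodic base ⇒ `E^top(g; κ, T, A) ∈ ECCellPeriodic s`** (eight
binders in order). [folklore] -/
theorem ecCellPeriodic_hypotheses_graphEscapeTopVariety (u₀ : ℂ)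
    (hP : Function.Injective (aeval (fibreSlice (escapeTopFibrePoly κ T A) u₀) :
      MvPolynomial (Fin s) ℂ →ₐ[ℂ] MvPolynomial (Fin s) ℂ))
    (hg : 2 ≤ g.totalDegree) (hper : HasIntegerPeriod ℂ (graphBase g)) :
    IsIrreducibleClosed ℂ (graphEscapeTopVariety g κ T A) ∧
    (graphEscapeTopVariety g κ T A ∩ torusLocus ℂ (s + 1)).Nonempty ∧
    IsRotund ℂ (s + 1) (graphEscapeTopVariety g κ T A ∩ torusLocus ℂ (s + 1)) ∧
    IsAddFree ℂ (s + 1) (graphEscapeTopVariety g κ T A ∩ torusLocus ℂ (s + 1)) ∧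
    IsMulFree ℂ (s + 1) (graphEscapeTopVariety g κ T A ∩ torusLocus ℂ (s + 1)) ∧
    zariskiDim ℂ (graphEscapeTopVariety g κ T A) = (s + 1 : ℕ) ∧
    addProjDim ℂ (s + 1) (graphEscapeTopVariety g κ T A) = (s : ℕ) ∧
    HasIntegerPeriod ℂ (projAdd '' (graphEscapeTopVariety g κ T A ∩ torusLocus ℂ (s + 1))) := by
  rw [graphEscapeTopVariety_eq_graphFibreVariety]
  exact ecCellPeriodic_hypotheses_graphFibreVariety g _ u₀ hP hg hper

/-- `ECCellAperiodic s` ⇒ `E^top(g; κ, T, A)` meets `Γ_exp` (dominant slice, `s ≥ 1`, aperiodic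
base). [folklore] -/
theorem graphEscapeTopVariety_inter_expGraph_nonempty_of_ecCellAperiodic (u₀ : ℂ)
    (hP : Function.Injective (aeval (fibreSlice (escapeTopFibrePoly κ T A) u₀) :
      MvPolynomial (Fin s) ℂ →ₐ[ℂ] MvPolynomial (Fin s) ℂ))
    (hs : 0 < s) (haper : ¬ HasIntegerPeriod ℂ (graphBase g)) (h : ECCellAperiodic s) :
    (graphEscapeTopVariety g κ T A ∩ expGraph ℂ (s + 1)).Nonempty := by
  rw [graphEscapeTopVariety_eq_graphFibreVariety]
  exact graphFibreVariety_inter_expGraph_nonempty_of_ecCellAperiodic g _ u₀ hP hs haper h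

/-- `ECCellPeriodic s` ⇒ `E^top(g; κ, T, A)` meets `Γ_exp` (dominant slice, `deg g ≥ 2`, periodic
base). [folklore] -/
theorem graphEscapeTopVariety_inter_expGraph_nonempty_of_ecCellPeriodic (u₀ : ℂ)
    (hP : Function.Injective (aeval (fibreSlice (escapeTopFibrePoly κ T A) u₀) :
      MvPolynomial (Fin s) ℂ →ₐ[ℂ] MvPolynomial (Fin s) ℂ))
    (hg : 2 ≤ g.totalDegree) (hper : HasIntegerPeriod ℂ (graphBase g)) (h : ECCellPeriodic s) :
    (graphEscapeTopVariety g κ T A ∩ expGraph ℂ (s + 1)).Nonempty := by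
  rw [graphEscapeTopVariety_eq_graphFibreVariety]
  exact graphFibreVariety_inter_expGraph_nonempty_of_ecCellPeriodic g _ u₀ hP hg hper h

/-- **Exponential points of `E^top(g; κ, T, A)` ↔ solutions of**
`exp xⱼ = Tⱼ(x) (e^{g(x)})^{κⱼ} + Σ_{i<κⱼ} A_{j,i}(x) (e^{g(x)})^i` — EXACTLY the conclusion of
`Summit.….exists_expPoint_graphEscape_top`. [folklore] -/
theorem graphEscapeTopVariety_inter_expGraph_nonempty_iff :
    (graphEscapeTopVariety g κ T A ∩ expGraph ℂ (s + 1)).Nonempty ↔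
      ∃ x : Fin s → ℂ, ∀ j, Complex.exp (x j) =
        eval x (T j) * Complex.exp (eval x g) ^ (κ j) +
          ∑ i ∈ Finset.range (κ j), eval x (A j i) * Complex.exp (eval x g) ^ i := by
  rw [graphEscapeTopVariety_eq_graphFibreVariety, graphFibreVariety_inter_expGraph_nonempty_iff]
  refine exists_congr fun x => forall_congr' fun j => ?_
  simp only [escapeTopFibrePoly, map_add, map_mul, map_pow, map_sum, eval_X, Fin.cons_zero,
    eval_rename, cons_comp_succ]

end EscapeTopFibres

/-! ### Tools for explicit models over `ℂ²` -/

section ModelTools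

/-- `x' ↦ (x₂, x₁)` is an involution of `ℂ[x₁, x₂]`, hence dominant. [folklore] -/
theorem aeval_swap_injective :
    Function.Injective (aeval (![X 1, X 0] : Fin 2 → MvPolynomial (Fin 2) ℂ) :
      MvPolynomial (Fin 2) ℂ →ₐ[ℂ] MvPolynomial (Fin 2) ℂ) := by
  have hcomp : (aeval (![X 1, X 0] : Fin 2 → MvPolynomial (Fin 2) ℂ) :
      MvPolynomial (Fin 2) ℂ →ₐ[ℂ] MvPolynomial (Fin 2) ℂ).comp (aeval ![X 1, X 0]) = AlgHom.id ℂ _ := by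
    refine MvPolynomial.algHom_ext fun j => ?_
    fin_cases j <;> simp
  have hleft : Function.LeftInverse
      (aeval (![X 1, X 0] : Fin 2 → MvPolynomial (Fin 2) ℂ) : MvPolynomial (Fin 2) ℂ →ₐ[ℂ] _)
      (aeval ![X 1, X 0]) := fun p => by
    simpa using congrArg (fun f => f p) hcomp
  exact hleft.injective

/-- `x' ↦ (x₁ + 1, x₂ + 1)` is dominant (a translation). [folklore] -/
theorem aeval_translate_one_injective :
    Function.Injective (aeval (fun j : Fin 2 => C (1 : ℂ) + X j) :
      MvPolynomial (Fin 2) ℂ →ₐ[ℂ] MvPolynomial (Fin 2) ℂ) := by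
  rw [aeval_C_add_injective_iff (fun _ => (1 : ℂ)) X]
  intro p q h
  simpa [aeval_X_left_apply] using h

/-- A polynomial vanishing identically after an integer translation test: if
`g(x + w') = g(x) + w₃` for all `x ∈ ℂ²` forces `w = 0`, the graph base of `g` is aperiodic — the
point form `hasIntegerPeriod_graphBase_iff_eval`, restated for convenience. [folklore] -/
theorem not_hasIntegerPeriod_graphBase_of_eval (g : MvPolynomial (Fin 2) ℂ)
    (h : ∀ w : Fin (2 + 1) → ℤ,
      (∀ x : Fin 2 → ℂ, eval (x + fun i => (w (Fin.castSucc i) : ℂ)) g =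
        eval x g + (w (Fin.last 2) : ℂ)) → w = 0) :
    ¬ HasIntegerPeriod ℂ (graphBase g) := by
  rw [hasIntegerPeriod_graphBase_iff_eval]
  rintro ⟨w, hw, hper⟩
  exact hw (h w hper)

/-- `w ∈ ℤ³` vanishes iff its three coordinates do. [folklore] -/
theorem int_vec_three_eq_zero {w : Fin (2 + 1) → ℤ} (h0 : w (Fin.castSucc 0) = 0)
    (h1 : w (Fin.castSucc 1) = 0) (h2 : w (Fin.last 2) = 0) : w = 0 := by
  funext i
  induction i using Fin.lastCases with
  | last => exact h2
  | cast j =>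
    fin_cases j
    · exact h0
    · exact h1

/-- `Fin.cons a p 2 = p 1` on `Fin 3` (the index `2` of `ℂ[u, x₁, x₂]` is `x₂`). [folklore] -/
@[simp] theorem cons_apply_two {α : Type*} (a : α) (p : Fin 2 → α) :
    (Fin.cons a p : Fin (2 + 1) → α) 2 = p 1 := rfl

end ModelTools

/-! ### The cubic mixed-powers model `{x₃ = x₁³ + x₂³, y₁ = y₃ + x₁, y₂ = y₃² - x₂}` -/

section CubicModel

/-- The cubic base polynomial `x₁³ + x₂³`. [folklore] -/
def cubicBase : MvPolynomial (Fin 2) ℂ := X 0 ^ 3 + X 1 ^ 3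

/-- Evaluation of the cubic base. [folklore] -/
theorem eval_cubicBase (x : Fin 2 → ℂ) : eval x cubicBase = x 0 ^ 3 + x 1 ^ 3 := by
  simp [cubicBase, map_add, map_pow, eval_X]

/-- The mixed-powers fibres `(u + x₁, u² - x₂) ∈ ℂ[u, x₁, x₂]²`. [folklore] -/
def mixedPowersFibrePoly : Fin 2 → MvPolynomial (Fin (2 + 1)) ℂ := ![X 0 + X 1, X 0 ^ 2 - X 2]

/-- The slice of the mixed-powers fibres at `u₀ = 0` is the involution `(x₁, -x₂)`. [folklore] -/
theorem fibreSlice_mixedPowersFibrePoly_zero : fibreSlice mixedPowersFibrePoly 0 = mmPowerOffsets := by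
  funext j
  fin_cases j <;> simp [fibreSlice, mixedPowersFibrePoly, mmPowerOffsets]

/-- **The cubic mixed-powers model** `{x₃ = x₁³ + x₂³, y₁ = y₃ + x₁, y₂ = y₃² - x₂} ⊆ ℂ³ × ℂ³` —
the 3-fold of the problem side's `cubic_mixedPowers_model_system_solvable`.
[cite: MantovaMasser2023, §1 p. 5 (the open case dim π(V) = 2 in ℂ³ × (ℂˣ)³)] -/
def cubicMixedPowersModel : Set (Fin 3 ⊕ Fin 3 → ℂ) :=
  graphFibreVariety cubicBase mixedPowersFibrePoly

/-- Membership in the cubic mixed-powers model, explicit `Fin 3` indices. [folklore] -/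
theorem mem_cubicMixedPowersModel_iff (z : Fin 3 ⊕ Fin 3 → ℂ) :
    z ∈ cubicMixedPowersModel ↔
      z (Sum.inl 2) = z (Sum.inl 0) ^ 3 + z (Sum.inl 1) ^ 3 ∧
        z (Sum.inr 0) = z (Sum.inr 2) + z (Sum.inl 0) ∧
        z (Sum.inr 1) = z (Sum.inr 2) ^ 2 - z (Sum.inl 1) := by
  simp only [cubicMixedPowersModel, mem_graphFibreVariety_iff, eval_cubicBase, Fin.forall_fin_two]
  constructor
  · rintro ⟨h3, h1, h2⟩
    exact ⟨by simpa using h3, by simpa [mixedPowersFibrePoly] using h1,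
      by simpa [mixedPowersFibrePoly] using h2⟩
  · rintro ⟨h3, h1, h2⟩
    exact ⟨by simpa using h3, by simpa [mixedPowersFibrePoly] using h1,
      by simpa [mixedPowersFibrePoly] using h2⟩

/-- **The cubic base `x₃ = x₁³ + x₂³` is aperiodic** (test points `0, ±e₁, ±e₂`). [folklore] -/
theorem not_hasIntegerPeriod_graphBase_cubicBase : ¬ HasIntegerPeriod ℂ (graphBase cubicBase) := by
  refine not_hasIntegerPeriod_graphBase_of_eval _ fun w hw => ?_
  have h0 := hw 0
  have h1 := hw ![1, 0]
  have h2 := hw ![-1, 0]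
  have h3 := hw ![0, 1]
  have h4 := hw ![0, -1]
  simp only [eval_cubicBase, Pi.add_apply, Pi.zero_apply, Matrix.cons_val_zero, Matrix.cons_val_one,
    zero_add] at h0 h1 h2 h3 h4
  have hw0 : (w (Fin.castSucc 0) : ℂ) = 0 := by linear_combination (h1 + h2 - 2 * h0) / 6
  have hw1 : (w (Fin.castSucc 1) : ℂ) = 0 := by linear_combination (h3 + h4 - 2 * h0) / 6
  have hw2 : (w (Fin.last 2) : ℂ) = 0 := by
    rw [hw0, hw1] at h0
    linear_combination -h0
  exact int_vec_three_eq_zero (by exact_mod_cast hw0) (by exact_mod_cast hw1) (by exact_mod_cast hw2)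

/-- **The cubic mixed-powers model is a certified member of `ECCellAperiodic 2`** (seven binders in
order). [folklore] -/
theorem ecCellAperiodic_hypotheses_cubicMixedPowersModel :
    IsIrreducibleClosed ℂ cubicMixedPowersModel ∧
    (cubicMixedPowersModel ∩ torusLocus ℂ 3).Nonempty ∧
    IsAddFree ℂ 3 (cubicMixedPowersModel ∩ torusLocus ℂ 3) ∧
    IsMulFree ℂ 3 (cubicMixedPowersModel ∩ torusLocus ℂ 3) ∧
    zariskiDim ℂ cubicMixedPowersModel = (3 : ℕ) ∧
    addProjDim ℂ 3 cubicMixedPowersModel = (2 : ℕ) ∧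
    ¬ HasIntegerPeriod ℂ (projAdd '' (cubicMixedPowersModel ∩ torusLocus ℂ 3)) :=
  ecCellAperiodic_hypotheses_graphFibreVariety cubicBase mixedPowersFibrePoly 0
    (by rw [fibreSlice_mixedPowersFibrePoly_zero]; exact aeval_mmPowerOffsets_injective) two_pos
    not_hasIntegerPeriod_graphBase_cubicBase

/-- `ECCellAperiodic 2` ⇒ the cubic mixed-powers model meets `Γ_exp`. [folklore] -/
theorem cubicMixedPowersModel_inter_expGraph_nonempty_of_ecCellAperiodic (h : ECCellAperiodic 2) :
    (cubicMixedPowersModel ∩ expGraph ℂ 3).Nonempty :=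
  graphFibreVariety_inter_expGraph_nonempty_of_ecCellAperiodic cubicBase mixedPowersFibrePoly 0
    (by rw [fibreSlice_mixedPowersFibrePoly_zero]; exact aeval_mmPowerOffsets_injective) two_pos
    not_hasIntegerPeriod_graphBase_cubicBase h

/-- **Exponential points of the cubic mixed-powers model ↔ solutions of**
`e^z = e^{z³+w³} + z ∧ e^w = (e^{z³+w³})² - w` — the problem side's
`cubic_mixedPowers_model_system_solvable`, verbatim. [folklore] -/
theorem cubicMixedPowersModel_inter_expGraph_nonempty_iff :
    (cubicMixedPowersModel ∩ expGraph ℂ 3).Nonempty ↔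
      ∃ z w : ℂ, Complex.exp z = Complex.exp (z ^ 3 + w ^ 3) + z ∧
        Complex.exp w = Complex.exp (z ^ 3 + w ^ 3) ^ 2 - w := by
  rw [cubicMixedPowersModel, graphFibreVariety_inter_expGraph_nonempty_iff]
  have key : ∀ x : Fin 2 → ℂ,
      (∀ j, Complex.exp (x j) =
        eval (Fin.cons (Complex.exp (eval x cubicBase)) x : Fin (2 + 1) → ℂ) (mixedPowersFibrePoly j)) ↔
      (Complex.exp (x 0) = Complex.exp (x 0 ^ 3 + x 1 ^ 3) + x 0 ∧
        Complex.exp (x 1) = Complex.exp (x 0 ^ 3 + x 1 ^ 3) ^ 2 - x 1) := by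
    intro x
    rw [Fin.forall_fin_two, eval_cubicBase]
    simp only [mixedPowersFibrePoly, Matrix.cons_val_zero, Matrix.cons_val_one,
      map_add, map_sub, map_pow, eval_X, Fin.cons_zero, Fin.cons_one]
    rfl
  constructor
  · rintro ⟨x, hx⟩
    exact ⟨x 0, x 1, (key x).1 hx⟩
  · rintro ⟨z, w, hzw⟩
    refine ⟨![z, w], (key ![z, w]).2 ?_⟩
    simpa using hzw

end CubicModel

/-! ### The quartic model `{x₃ = x₁x₂³, y₁ = y₃ + x₂, y₂ = y₃ + x₁}` -/

section QuarticModel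

/-- The quartic base polynomial `x₁x₂³`. [folklore] -/
def quarticBase : MvPolynomial (Fin 2) ℂ := X 0 * X 1 ^ 3

/-- Evaluation of the quartic base. [folklore] -/
theorem eval_quarticBase (x : Fin 2 → ℂ) : eval x quarticBase = x 0 * x 1 ^ 3 := by
  simp [quarticBase, map_mul, map_pow, eval_X]

/-- The swapped-offset fibres `(u + x₂, u + x₁) ∈ ℂ[u, x₁, x₂]²`. [folklore] -/
def swapOffsetFibrePoly : Fin 2 → MvPolynomial (Fin (2 + 1)) ℂ := ![X 0 + X 2, X 0 + X 1]

/-- The slice of the swapped-offset fibres at `u₀ = 0` is the swap `(x₂, x₁)`. [folklore] -/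
theorem fibreSlice_swapOffsetFibrePoly_zero :
    fibreSlice swapOffsetFibrePoly 0 = (![X 1, X 0] : Fin 2 → MvPolynomial (Fin 2) ℂ) := by
  funext j
  fin_cases j <;> simp [fibreSlice, swapOffsetFibrePoly]

/-- **The quartic model** `{x₃ = x₁x₂³, y₁ = y₃ + x₂, y₂ = y₃ + x₁} ⊆ ℂ³ × ℂ³` — the 3-fold of the
problem side's `quartic_model_system_solvable`.
[cite: MantovaMasser2023, §1 p. 5 (the open case dim π(V) = 2 in ℂ³ × (ℂˣ)³)] -/
def quarticModel : Set (Fin 3 ⊕ Fin 3 → ℂ) :=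
  graphFibreVariety quarticBase swapOffsetFibrePoly

/-- Membership in the quartic model, explicit `Fin 3` indices. [folklore] -/
theorem mem_quarticModel_iff (z : Fin 3 ⊕ Fin 3 → ℂ) :
    z ∈ quarticModel ↔
      z (Sum.inl 2) = z (Sum.inl 0) * z (Sum.inl 1) ^ 3 ∧
        z (Sum.inr 0) = z (Sum.inr 2) + z (Sum.inl 1) ∧
        z (Sum.inr 1) = z (Sum.inr 2) + z (Sum.inl 0) := by
  simp only [quarticModel, mem_graphFibreVariety_iff, eval_quarticBase, Fin.forall_fin_two]
  constructor
  · rintro ⟨h3, h1, h2⟩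
    exact ⟨by simpa using h3, by simpa [swapOffsetFibrePoly] using h1,
      by simpa [swapOffsetFibrePoly] using h2⟩
  · rintro ⟨h3, h1, h2⟩
    exact ⟨by simpa using h3, by simpa [swapOffsetFibrePoly] using h1,
      by simpa [swapOffsetFibrePoly] using h2⟩

/-- **The quartic base `x₃ = x₁x₂³` is aperiodic** (test points `0, e₁, e₂, 2e₂`). [folklore] -/
theorem not_hasIntegerPeriod_graphBase_quarticBase : ¬ HasIntegerPeriod ℂ (graphBase quarticBase) := by
  refine not_hasIntegerPeriod_graphBase_of_eval _ fun w hw => ?_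
  have h0 := hw 0
  have h1 := hw ![1, 0]
  have h2 := hw ![0, 1]
  have h3 := hw ![0, 2]
  simp only [eval_quarticBase, Pi.add_apply, Pi.zero_apply, Matrix.cons_val_zero, Matrix.cons_val_one,
    zero_add] at h0 h1 h2 h3
  have hw1 : (w (Fin.castSucc 1) : ℂ) = 0 := by
    have h13 : (w (Fin.castSucc 1) : ℂ) ^ 3 = 0 := by linear_combination h1 - h0
    exact pow_eq_zero_iff (n := 3) (by norm_num) |>.1 h13
  have hw0 : (w (Fin.castSucc 0) : ℂ) = 0 := by
    rw [hw1] at h2 h3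
    linear_combination (h3 - h2) / 7
  have hw2 : (w (Fin.last 2) : ℂ) = 0 := by
    rw [hw0, hw1] at h0
    linear_combination -h0
  exact int_vec_three_eq_zero (by exact_mod_cast hw0) (by exact_mod_cast hw1) (by exact_mod_cast hw2)

/-- **The quartic model is a certified member of `ECCellAperiodic 2`** (seven binders in order).
[folklore] -/
theorem ecCellAperiodic_hypotheses_quarticModel :
    IsIrreducibleClosed ℂ quarticModel ∧
    (quarticModel ∩ torusLocus ℂ 3).Nonempty ∧
    IsAddFree ℂ 3 (quarticModel ∩ torusLocus ℂ 3) ∧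
    IsMulFree ℂ 3 (quarticModel ∩ torusLocus ℂ 3) ∧
    zariskiDim ℂ quarticModel = (3 : ℕ) ∧
    addProjDim ℂ 3 quarticModel = (2 : ℕ) ∧
    ¬ HasIntegerPeriod ℂ (projAdd '' (quarticModel ∩ torusLocus ℂ 3)) :=
  ecCellAperiodic_hypotheses_graphFibreVariety quarticBase swapOffsetFibrePoly 0
    (by rw [fibreSlice_swapOffsetFibrePoly_zero]; exact aeval_swap_injective) two_pos
    not_hasIntegerPeriod_graphBase_quarticBase

/-- `ECCellAperiodic 2` ⇒ the quartic model meets `Γ_exp`. [folklore] -/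
theorem quarticModel_inter_expGraph_nonempty_of_ecCellAperiodic (h : ECCellAperiodic 2) :
    (quarticModel ∩ expGraph ℂ 3).Nonempty :=
  graphFibreVariety_inter_expGraph_nonempty_of_ecCellAperiodic quarticBase swapOffsetFibrePoly 0
    (by rw [fibreSlice_swapOffsetFibrePoly_zero]; exact aeval_swap_injective) two_pos
    not_hasIntegerPeriod_graphBase_quarticBase h

/-- **Exponential points of the quartic model ↔ solutions of** `e^z = e^{zw³} + w ∧ e^w = e^{zw³} + z`
— the problem side's `quartic_model_system_solvable`, verbatim. [folklore] -/
theorem quarticModel_inter_expGraph_nonempty_iff :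
    (quarticModel ∩ expGraph ℂ 3).Nonempty ↔
      ∃ z w : ℂ, Complex.exp z = Complex.exp (z * w ^ 3) + w ∧
        Complex.exp w = Complex.exp (z * w ^ 3) + z := by
  rw [quarticModel, graphFibreVariety_inter_expGraph_nonempty_iff]
  have key : ∀ x : Fin 2 → ℂ,
      (∀ j, Complex.exp (x j) =
        eval (Fin.cons (Complex.exp (eval x quarticBase)) x : Fin (2 + 1) → ℂ) (swapOffsetFibrePoly j)) ↔
      (Complex.exp (x 0) = Complex.exp (x 0 * x 1 ^ 3) + x 1 ∧
        Complex.exp (x 1) = Complex.exp (x 0 * x 1 ^ 3) + x 0) := by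
    intro x
    rw [Fin.forall_fin_two, eval_quarticBase]
    simp only [swapOffsetFibrePoly, Matrix.cons_val_zero, Matrix.cons_val_one,
      map_add, eval_X, Fin.cons_zero, Fin.cons_one]
    rfl
  constructor
  · rintro ⟨x, hx⟩
    exact ⟨x 0, x 1, (key x).1 hx⟩
  · rintro ⟨z, w, hzw⟩
    refine ⟨![z, w], (key ![z, w]).2 ?_⟩
    simpa using hzw

end QuarticModel

/-! ### The moving-top model `{x₃ = x₁² + x₂², y₁ = x₁y₃ + 1, y₂ = x₂y₃ + 1}` -/

section MovingTopModel

/-- The paraboloid base polynomial `x₁² + x₂²`. [folklore] -/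
def paraboloidBase : MvPolynomial (Fin 2) ℂ := X 0 ^ 2 + X 1 ^ 2

/-- Evaluation of the paraboloid base. [folklore] -/
theorem eval_paraboloidBase (x : Fin 2 → ℂ) : eval x paraboloidBase = x 0 ^ 2 + x 1 ^ 2 := by
  simp [paraboloidBase, map_add, map_pow, eval_X]

/-- The moving-top fibres `(x₁u + 1, x₂u + 1) ∈ ℂ[u, x₁, x₂]²`. [folklore] -/
def movingTopFibrePoly : Fin 2 → MvPolynomial (Fin (2 + 1)) ℂ := ![X 1 * X 0 + 1, X 2 * X 0 + 1]

/-- The slice of the moving-top fibres at `u₀ = 1` is the translation `(x₁ + 1, x₂ + 1)`.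
[folklore] -/
theorem fibreSlice_movingTopFibrePoly_one :
    fibreSlice movingTopFibrePoly 1 = fun j : Fin 2 => C (1 : ℂ) + X j := by
  funext j
  fin_cases j <;> simp [fibreSlice, movingTopFibrePoly] <;> ring

/-- **The moving-top model** `{x₃ = x₁² + x₂², y₁ = x₁y₃ + 1, y₂ = x₂y₃ + 1} ⊆ ℂ³ × ℂ³` — the
3-fold of the problem side's `movingTop_model_system_solvable` (top `y₃`-coefficients `Tⱼ = xⱼ`).
[cite: MantovaMasser2023, §1 p. 5 (the open case dim π(V) = 2 in ℂ³ × (ℂˣ)³)] -/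
def movingTopModel : Set (Fin 3 ⊕ Fin 3 → ℂ) :=
  graphFibreVariety paraboloidBase movingTopFibrePoly

/-- Membership in the moving-top model, explicit `Fin 3` indices. [folklore] -/
theorem mem_movingTopModel_iff (z : Fin 3 ⊕ Fin 3 → ℂ) :
    z ∈ movingTopModel ↔
      z (Sum.inl 2) = z (Sum.inl 0) ^ 2 + z (Sum.inl 1) ^ 2 ∧
        z (Sum.inr 0) = z (Sum.inl 0) * z (Sum.inr 2) + 1 ∧
        z (Sum.inr 1) = z (Sum.inl 1) * z (Sum.inr 2) + 1 := by
  simp only [movingTopModel, mem_graphFibreVariety_iff, eval_paraboloidBase, Fin.forall_fin_two]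
  constructor
  · rintro ⟨h3, h1, h2⟩
    exact ⟨by simpa using h3, by simpa [movingTopFibrePoly] using h1,
      by simpa [movingTopFibrePoly] using h2⟩
  · rintro ⟨h3, h1, h2⟩
    exact ⟨by simpa using h3, by simpa [movingTopFibrePoly] using h1,
      by simpa [movingTopFibrePoly] using h2⟩

/-- **The paraboloid `x₃ = x₁² + x₂²` is aperiodic** (test points `0, ±e₁, ±e₂`). [folklore] -/
theorem not_hasIntegerPeriod_graphBase_paraboloidBase :
    ¬ HasIntegerPeriod ℂ (graphBase paraboloidBase) := by
  refine not_hasIntegerPeriod_graphBase_of_eval _ fun w hw => ?_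
  have h0 := hw 0
  have h1 := hw ![1, 0]
  have h2 := hw ![-1, 0]
  have h3 := hw ![0, 1]
  have h4 := hw ![0, -1]
  simp only [eval_paraboloidBase, Pi.add_apply, Pi.zero_apply, Matrix.cons_val_zero,
    Matrix.cons_val_one, zero_add] at h0 h1 h2 h3 h4
  have hw0 : (w (Fin.castSucc 0) : ℂ) = 0 := by linear_combination (h1 - h2) / 4
  have hw1 : (w (Fin.castSucc 1) : ℂ) = 0 := by linear_combination (h3 - h4) / 4
  have hw2 : (w (Fin.last 2) : ℂ) = 0 := by
    rw [hw0, hw1] at h0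
    linear_combination -h0
  exact int_vec_three_eq_zero (by exact_mod_cast hw0) (by exact_mod_cast hw1) (by exact_mod_cast hw2)

/-- **The moving-top model is a certified member of `ECCellAperiodic 2`** (seven binders in order).
[folklore] -/
theorem ecCellAperiodic_hypotheses_movingTopModel :
    IsIrreducibleClosed ℂ movingTopModel ∧
    (movingTopModel ∩ torusLocus ℂ 3).Nonempty ∧
    IsAddFree ℂ 3 (movingTopModel ∩ torusLocus ℂ 3) ∧
    IsMulFree ℂ 3 (movingTopModel ∩ torusLocus ℂ 3) ∧
    zariskiDim ℂ movingTopModel = (3 : ℕ) ∧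
    addProjDim ℂ 3 movingTopModel = (2 : ℕ) ∧
    ¬ HasIntegerPeriod ℂ (projAdd '' (movingTopModel ∩ torusLocus ℂ 3)) :=
  ecCellAperiodic_hypotheses_graphFibreVariety paraboloidBase movingTopFibrePoly 1
    (by rw [fibreSlice_movingTopFibrePoly_one]; exact aeval_translate_one_injective) two_pos
    not_hasIntegerPeriod_graphBase_paraboloidBase

/-- `ECCellAperiodic 2` ⇒ the moving-top model meets `Γ_exp`. [folklore] -/
theorem movingTopModel_inter_expGraph_nonempty_of_ecCellAperiodic (h : ECCellAperiodic 2) :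
    (movingTopModel ∩ expGraph ℂ 3).Nonempty :=
  graphFibreVariety_inter_expGraph_nonempty_of_ecCellAperiodic paraboloidBase movingTopFibrePoly 1
    (by rw [fibreSlice_movingTopFibrePoly_one]; exact aeval_translate_one_injective) two_pos
    not_hasIntegerPeriod_graphBase_paraboloidBase h

/-- **Exponential points of the moving-top model ↔ solutions of**
`e^z = z e^{z²+w²} + 1 ∧ e^w = w e^{z²+w²} + 1` — the problem side's
`movingTop_model_system_solvable`, verbatim. [folklore] -/
theorem movingTopModel_inter_expGraph_nonempty_iff :
    (movingTopModel ∩ expGraph ℂ 3).Nonempty ↔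
      ∃ z w : ℂ, Complex.exp z = z * Complex.exp (z ^ 2 + w ^ 2) + 1 ∧
        Complex.exp w = w * Complex.exp (z ^ 2 + w ^ 2) + 1 := by
  rw [movingTopModel, graphFibreVariety_inter_expGraph_nonempty_iff]
  have key : ∀ x : Fin 2 → ℂ,
      (∀ j, Complex.exp (x j) =
        eval (Fin.cons (Complex.exp (eval x paraboloidBase)) x : Fin (2 + 1) → ℂ)
          (movingTopFibrePoly j)) ↔
      (Complex.exp (x 0) = x 0 * Complex.exp (x 0 ^ 2 + x 1 ^ 2) + 1 ∧
        Complex.exp (x 1) = x 1 * Complex.exp (x 0 ^ 2 + x 1 ^ 2) + 1) := by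
    intro x
    rw [Fin.forall_fin_two, eval_paraboloidBase]
    simp only [movingTopFibrePoly, Matrix.cons_val_zero, Matrix.cons_val_one,
      map_add, map_mul, map_one, eval_X, Fin.cons_zero, Fin.cons_one]
    rfl
  constructor
  · rintro ⟨x, hx⟩
    exact ⟨x 0, x 1, (key x).1 hx⟩
  · rintro ⟨z, w, hzw⟩
    refine ⟨![z, w], (key ![z, w]).2 ?_⟩
    simpa using hzw

end MovingTopModel

/-! ### A periodic-base member solved by the escape theorems:
`{x₃ = (x₁ - x₂)³, y₁ = y₃ + x₁, y₂ = y₃² - x₂}` -/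

section PeriodicCubicModel

/-- The periodic cubic base polynomial `(x₁ - x₂)³` (period `(1, 1, 0)`). [folklore] -/
def periodicCubicBase : MvPolynomial (Fin 2) ℂ := (X 0 - X 1) ^ 3

/-- Evaluation of the periodic cubic base. [folklore] -/
theorem eval_periodicCubicBase (x : Fin 2 → ℂ) : eval x periodicCubicBase = (x 0 - x 1) ^ 3 := by
  simp [periodicCubicBase, map_sub, map_pow, eval_X]

/-- `deg (x₁ - x₂)³ = 3`. [folklore] -/
theorem totalDegree_periodicCubicBase : periodicCubicBase.totalDegree = 3 := by
  have hhom : periodicCubicBase.IsHomogeneous 3 := by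
    have h1 : (X 0 - X 1 : MvPolynomial (Fin 2) ℂ).IsHomogeneous 1 :=
      (isHomogeneous_X ℂ 0).sub (isHomogeneous_X ℂ 1)
    simpa [periodicCubicBase] using h1.pow 3
  refine hhom.totalDegree ?_
  intro h
  have := congrArg (eval ![(1 : ℂ), 0]) h
  rw [eval_periodicCubicBase, map_zero] at this
  norm_num at this

/-- **The base `x₃ = (x₁ - x₂)³` has the integer period `(1, 1, 0)`.** [folklore] -/
theorem hasIntegerPeriod_graphBase_periodicCubicBase :
    HasIntegerPeriod ℂ (graphBase periodicCubicBase) := by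
  rw [hasIntegerPeriod_graphBase_iff_eval]
  refine ⟨Fin.snoc (fun _ => 1) 0, ?_, fun x => ?_⟩
  · intro h
    have := congrFun h (Fin.castSucc 0)
    simp at this
  · simp only [eval_periodicCubicBase, Pi.add_apply, Fin.snoc_castSucc, Fin.snoc_last, Int.cast_one,
      Int.cast_zero, add_zero]
    ring

/-- **The periodic cubic model** `{x₃ = (x₁ - x₂)³, y₁ = y₃ + x₁, y₂ = y₃² - x₂} ⊆ ℂ³ × ℂ³`: the
mixed-powers fibres over a PERIODIC cubic base. Its system
`e^z = e^{(z-w)³} + z ∧ e^w = (e^{(z-w)³})² - w` is the instance `g = (x₁ - x₂)³`, `κ = (1, 2)`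
(`g₃(κ) = -1 ≠ 0`), `c = (1, 1)`, `A = (x₁, -x₂)` of the problem side's
`exists_expPoint_graphEscape_powers`. [cite: MantovaMasser2023, §1 p. 5 (the open case
dim π(V) = 2 in ℂ³ × (ℂˣ)³)] -/
def periodicCubicModel : Set (Fin 3 ⊕ Fin 3 → ℂ) :=
  graphFibreVariety periodicCubicBase mixedPowersFibrePoly

/-- Membership in the periodic cubic model, explicit `Fin 3` indices. [folklore] -/
theorem mem_periodicCubicModel_iff (z : Fin 3 ⊕ Fin 3 → ℂ) :
    z ∈ periodicCubicModel ↔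
      z (Sum.inl 2) = (z (Sum.inl 0) - z (Sum.inl 1)) ^ 3 ∧
        z (Sum.inr 0) = z (Sum.inr 2) + z (Sum.inl 0) ∧
        z (Sum.inr 1) = z (Sum.inr 2) ^ 2 - z (Sum.inl 1) := by
  simp only [periodicCubicModel, mem_graphFibreVariety_iff, eval_periodicCubicBase, Fin.forall_fin_two]
  constructor
  · rintro ⟨h3, h1, h2⟩
    exact ⟨by simpa using h3, by simpa [mixedPowersFibrePoly] using h1,
      by simpa [mixedPowersFibrePoly] using h2⟩
  · rintro ⟨h3, h1, h2⟩
    exact ⟨by simpa using h3, by simpa [mixedPowersFibrePoly] using h1,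
      by simpa [mixedPowersFibrePoly] using h2⟩

/-- **The periodic cubic model is a certified member of `ECCellPeriodic 2`** (eight binders in
order: irreducible closed, meets `G³`, rotund, additively and multiplicatively free, `dim = 3`,
`dim π₁ = 2`, periodic base). [folklore] -/
theorem ecCellPeriodic_hypotheses_periodicCubicModel :
    IsIrreducibleClosed ℂ periodicCubicModel ∧
    (periodicCubicModel ∩ torusLocus ℂ 3).Nonempty ∧
    IsRotund ℂ 3 (periodicCubicModel ∩ torusLocus ℂ 3) ∧
    IsAddFree ℂ 3 (periodicCubicModel ∩ torusLocus ℂ 3) ∧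
    IsMulFree ℂ 3 (periodicCubicModel ∩ torusLocus ℂ 3) ∧
    zariskiDim ℂ periodicCubicModel = (3 : ℕ) ∧
    addProjDim ℂ 3 periodicCubicModel = (2 : ℕ) ∧
    HasIntegerPeriod ℂ (projAdd '' (periodicCubicModel ∩ torusLocus ℂ 3)) :=
  ecCellPeriodic_hypotheses_graphFibreVariety periodicCubicBase mixedPowersFibrePoly 0
    (by rw [fibreSlice_mixedPowersFibrePoly_zero]; exact aeval_mmPowerOffsets_injective)
    (by rw [totalDegree_periodicCubicBase]; norm_num) hasIntegerPeriod_graphBase_periodicCubicBase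

/-- `ECCellPeriodic 2` ⇒ the periodic cubic model meets `Γ_exp`. [folklore] -/
theorem periodicCubicModel_inter_expGraph_nonempty_of_ecCellPeriodic (h : ECCellPeriodic 2) :
    (periodicCubicModel ∩ expGraph ℂ 3).Nonempty :=
  graphFibreVariety_inter_expGraph_nonempty_of_ecCellPeriodic periodicCubicBase mixedPowersFibrePoly 0
    (by rw [fibreSlice_mixedPowersFibrePoly_zero]; exact aeval_mmPowerOffsets_injective)
    (by rw [totalDegree_periodicCubicBase]; norm_num) hasIntegerPeriod_graphBase_periodicCubicBase h

/-- **Exponential points of the periodic cubic model ↔ solutions of**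
`e^z = e^{(z-w)³} + z ∧ e^w = (e^{(z-w)³})² - w`. [folklore] -/
theorem periodicCubicModel_inter_expGraph_nonempty_iff :
    (periodicCubicModel ∩ expGraph ℂ 3).Nonempty ↔
      ∃ z w : ℂ, Complex.exp z = Complex.exp ((z - w) ^ 3) + z ∧
        Complex.exp w = Complex.exp ((z - w) ^ 3) ^ 2 - w := by
  rw [periodicCubicModel, graphFibreVariety_inter_expGraph_nonempty_iff]
  have key : ∀ x : Fin 2 → ℂ,
      (∀ j, Complex.exp (x j) =
        eval (Fin.cons (Complex.exp (eval x periodicCubicBase)) x : Fin (2 + 1) → ℂ)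
          (mixedPowersFibrePoly j)) ↔
      (Complex.exp (x 0) = Complex.exp ((x 0 - x 1) ^ 3) + x 0 ∧
        Complex.exp (x 1) = Complex.exp ((x 0 - x 1) ^ 3) ^ 2 - x 1) := by
    intro x
    rw [Fin.forall_fin_two, eval_periodicCubicBase]
    simp only [mixedPowersFibrePoly, Matrix.cons_val_zero, Matrix.cons_val_one,
      map_add, map_sub, map_pow, eval_X, Fin.cons_zero, Fin.cons_one]
    rfl
  constructor
  · rintro ⟨x, hx⟩
    exact ⟨x 0, x 1, (key x).1 hx⟩
  · rintro ⟨z, w, hzw⟩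
    refine ⟨![z, w], (key ![z, w]).2 ?_⟩
    simpa using hzw

/-- **The escape system of the periodic cubic model is an instance of the problem side's monomial
escape shape** `exp xⱼ = cⱼ (e^{g(x)})^{κⱼ} + Aⱼ(x)` with `g = (x₁ - x₂)³`, `κ = (1, 2)`, `c = 1`,
`A = (x₁, -x₂)` — so `exists_expPoint_graphEscape_powers` (whose hypothesis `g₃(κ) = -1 ≠ 0` holds)
settles this member of the PERIODIC half; the composition lives problem-side. [folklore] -/
theorem periodicCubicModel_inter_expGraph_nonempty_of_powers_shape
    (h : ∃ x : Fin 2 → ℂ, ∀ j, Complex.exp (x j) =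
      (![1, 1] : Fin 2 → ℂ) j * Complex.exp (eval x periodicCubicBase) ^ ((![1, 2] : Fin 2 → ℕ) j) +
        eval x (mmPowerOffsets j)) :
    (periodicCubicModel ∩ expGraph ℂ 3).Nonempty := by
  rw [periodicCubicModel_inter_expGraph_nonempty_iff]
  obtain ⟨x, hx⟩ := h
  refine ⟨x 0, x 1, ?_, ?_⟩
  · have h0 := hx 0
    simp only [eval_periodicCubicBase, mmPowerOffsets, Matrix.cons_val_zero, pow_one, one_mul,
      eval_X] at h0
    exact h0
  · have h1 := hx 1
    simp only [eval_periodicCubicBase, mmPowerOffsets, Matrix.cons_val_one, Matrix.cons_val_zero,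
      one_mul, map_neg, eval_X] at h1
    rw [h1]
    ring

end PeriodicCubicModel

end Literature.ModelTheory.Zilber
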